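import Mathlib.Algebra.Order.Ring.Int
import Mathlib.Algebra.Group.Even
import Mathlib.Tactic.Ring
import Mathlib.Tactic.Linarith
import Mathlib.Tactic.LinearCombination
import HarnessLib

/-!
# Mukai-vector numerics on an abelian or K3 surface AS PRINTED: `χ(E, F) = −(v(E).v(F))`, `dim Ext¹(E, E) = (v²) + 2 dim End E`,
# the dimension `c₁² − 2rχ + r²χ(𝒪_S) + 2 = (v²) + 2` of `Spl_S`, and «rigid ⟺ (v²) = −2 ⟺ (v²) < 0» (Mukai 1984, 1987)

`Literature/AlgebraicGeometry/ModuliOfSheaves/MukaiVectorNumerics.lean`, namespace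
`Literature.AlgebraicGeometry.ModuliOfSheaves.Mukai1987Numerics`. Family `hodge`; typed by the literature seat `lit-w-mukai`
of the venture cell `pub-hsemireg` (Mukai AS PRINTED). HONEST FRAMING: the ARITHMETIC of the printed statements only —
Hirzebruch–Riemann–Roch, Serre duality and the smoothness of `Spl_S` enter as HYPOTHESES on integers (dimensions of `Ext`
groups) and on a bilinear form (the intersection form); no surface, sheaf or moduli space is constructed; nothing here bears
on the Hodge conjecture. No definition, no named fact, no `sorry`. Purpose: to pin the printed sign and shift conventions
(`(v²) + 2`, not `2 − (v²)`; `s = χ − r` on a K3 surface, `s = χ` on an abelian surface) that the tree's K3 files take BY VALUE.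

## The printed statements (verbatim; [Muk87-K3] by eye from the author's scan of the Tata volume, ×2 across seats in the
## cell's locator sheet (12.1)/(12.4)/(12.5) and re-read by eye on this file by a second seat (lit-3 g61, 200–800 dpi:
## CONCUR word for word; locators below as corrected by that read); [Muk84] by eye from the GDZ page images, sheet (11.2))

* [Mukai1987ModuliBundlesK3] p. 342 (1.1): «`(α.β) = −α⁰ ∪ β⁴ + α² ∪ β² − α⁴ ∪ β⁰`»; p. 350 DEFINITION 2.1: «For a sheaf `E`, we
  put `v(E) = ch(E)·√td_S ∈ H^{ev}(S, ℤ)` and call it the vector associated to `E`. We define a symmetric integral bilinear form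
  `( . )` on `H^{ev}(S, ℤ)` by `(u.u′) = α ∪ α′ − r ∪ s′ − s ∪ r′ ∈ H⁴(S, ℤ) ≅ ℤ` for every `u = (r, α, s)` and
  `u′ = (r′, α′, s′)`»; p. 343 (§1 Introduction, `S` an algebraic K3 surface; lines 5–7): «The `H⁴(S)`-component of `v(E)` is
  denoted by `s(E)`. By the Riemann-Roch theorem, we have `s(E) = r(E) + ch²(E) = χ(E) − r(E)`» (K3 case; §2 standing
  hypothesis p. 350 «we assume that `S` is an abelian or K3 surface»; p. 351 lines 1–2: «`H̃(S, ℤ)` is an even lattice of rank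
  `8(1+2ε)` and isomorphic to `U^{⊥4} ⊥ E₈^{⊥2ε}` as an abstract lattice.»); p. 351 PROPOSITION 2.2: «Let `E` and `F` be
  sheaves on `S` and put `χ(E, F) = Σ_i(−1)^i dim Ext^i_{𝒪_S}(E, F)`. Then we have `χ(E, F) = −(v(E) . v(F))`.»; pp. 351–352
  PROPOSITION 2.3: «… the pairing `Ext^i(E, F) × Ext^{2−i}(F, E) → H²(𝒪_S)` … is nondegenerate for every `i` … In particular
  we have `dim Ext²(E, F) = dim Hom(F, E)` and `dim Ext¹(E, F) = dim Ext¹(F, E)`.»;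
  p. 352 PROPOSITION 2.4 (lead-in «By Proposition 2.2 and 2.3, we have»): «`(v(E). v(F)) = dim Ext¹(E, F) − dim Hom(E, F)
  − dim Hom(F, E)`.» [sic: in print the first minus sign is lost at a line break; the sign is forced by the lead-in and by
  Cor. 2.5 line 1]; p. 353 COROLLARY 2.5: «`dim Ext¹(E, E) = (v(E)²) + 2 dim End(E)` for every sheaf `E` on `S`. In
  particular, `dim Ext¹(E, E)` is always an even integer. If `E` is simple, then `dim Ext¹(E, E) = (v(E)²) + 2` [sic: printed
  «(v(E)² +2», closing parenthesis lost] and hence `(v(E)²) ≧ −2`.»; p. 353 COROLLARY 2.6: «Let `v` be a vector of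
  `H̃(S, ℤ)`. Then every component of `Spl_S(v)` is smooth and has dimension `(v²) + 2`.»; p. 366 PROPOSITION 3.2 (K3; lead-in
  «By Proposition 2.5 [sic], we have»): «If `E` is simple,
  then the following are equivalent: (1) `E` is rigid, (2) `(v(E)²) = −2`, and (3) `(v(E)²) < 0`.» (DEFINITION 3.1: «A sheaf
  `E` on `S` is rigid if `Ext¹_{𝒪_S}(E, E) = 0`.»)
* [Mukai1984] S. Mukai, *Symplectic structure of the moduli space of sheaves on an abelian or K3 surface*, Invent. Math. 77
  (1984), p. 101 THEOREM 0.1: «Assume that the canonical bundle of `S` is trivial, i.e., `S` is abelian or of type K3. Let `E₀`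
  be a simple sheaf on `S` … (1) `Spl_S` is smooth and its dimension at `[E₀]` is equal to
  `c₁(E₀)² − 2r(E₀)χ(E₀) + r(E₀)²χ(𝒪_S) + 2` …»; p. 102 THEOREM 0.3: «… its dimension at the point is equal to
  `c₁(E₀)² − 2r(E₀)ch²(E₀) − r(E₀)²χ(𝒪_S) + 1 + dim Hom_{𝒪_S}(E₀, E₀ ⊗ ω_S)`»; COROLLARY 0.2: «… `M(r, l, s)` is a smooth
  quasi-projective scheme with a symplectic structure and each component has dimension `l² − 2rs + 2`.»

## Rendering

`K` a commutative ring for the identities (`ℤ` in print), `B c c′` the intersection number `α ∪ α′`; a Mukai vector is a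
triple `(r, c, s)` with `(v.v′) = B c c′ − r s′ − s r′` ((1.1)/DEF 2.1, written out — no definition is introduced).
`χ(𝒪_S) = 2e` with `e = 1` (K3) or `e = 0` (abelian), `√td_S = (1, 0, e)`, so `v(E) = (r, c₁, ch₂ + e·r)` and HRR reads
`χ(E) = ch₂ + 2e·r`, `χ(E, F) = r·ch₂′ + r′·ch₂ − c₁.c₁′ + 2e·r r′` (for `K_S = 0`; HYPOTHESES, not proved here).
-/

namespace Literature.AlgebraicGeometry.ModuliOfSheaves

namespace Mukai1987Numerics

section RiemannRoch

variable {K : Type*} [CommRing K]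

/-- **`s(E) = χ(E) − r(E)` on a K3 surface, `s(E) = χ(E)` on an abelian surface** — the `H⁴`-component of
`v(E) = ch(E)·√td_S` is `ch₂ + e·r` with `χ(𝒪_S) = 2e`, and HRR gives `χ(E) = ch₂ + 2e·r`; so `s = χ(E) − e·r`.
[cite: Mukai1987ModuliBundlesK3, Def. 2.1 (p. 350) and p. 343 «s(E) = r(E) + ch²(E) = χ(E) − r(E)»] -/
theorem s_eq (r ch₂ e χE : K) (hRR : χE = ch₂ + 2 * e * r) : ch₂ + e * r = χE - e * r := by
  rw [hRR]; ring

/-- **PROPOSITION 2.2 from HRR (coordinates).** With `v = (r, c, ch₂ + e r)`, `v′ = (r′, c′, ch₂′ + e r′)`, the pairing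
`(v.v′) = c.c′ − r s′ − s r′` of (1.1)/DEF 2.1 and HRR `χ(E, F) = r ch₂′ + r′ ch₂ − c.c′ + 2e r r′` (`K_S` trivial,
`χ(𝒪_S) = 2e`): `χ(E, F) = −(v(E).v(F))`. [cite: Mukai1987ModuliBundlesK3, Prop. 2.2, p. 351] -/
theorem prop_2_2 (r r' ch₂ ch₂' e cc' χEF : K) (hRR : χEF = r * ch₂' + r' * ch₂ - cc' + 2 * e * (r * r')) :
    χEF = -(cc' - r * (ch₂' + e * r') - (ch₂ + e * r) * r') := by
  rw [hRR]; ring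

/-- **[Muk84] THM 0.1's dimension is THM 0.3's** (for `K_S` trivial and `E₀` simple, `dim Hom(E₀, E₀ ⊗ ω_S) = 1`): with HRR
`χ(E₀) = ch₂ + r·χ(𝒪_S)`, `c₁² − 2rχ(E₀) + r²χ(𝒪_S) + 2 = c₁² − 2r ch₂ − r²χ(𝒪_S) + 1 + 1`.
[cite: Mukai1984, Thm. 0.1 (1) p. 101 and Thm. 0.3 p. 102] -/
theorem thm_0_1_eq_thm_0_3 (c₁sq r ch₂ χO χE : K) (hRR : χE = ch₂ + r * χO) :
    c₁sq - 2 * r * χE + r ^ 2 * χO + 2 = c₁sq - 2 * r * ch₂ - r ^ 2 * χO + 1 + 1 := by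
  rw [hRR]; ring

/-- **[Muk84] THM 0.1 / COR 0.2 = [Muk87-K3] COR 2.6**: with `s = χ(E) − e·r`, `χ(𝒪_S) = 2e`,
`c₁² − 2rχ(E) + r²χ(𝒪_S) + 2 = (c₁² − 2 r s) + 2 = (v²) + 2` («`l² − 2rs + 2`»).
[cite: Mukai1984, Thm. 0.1 (1) p. 101 and Cor. 0.2 p. 102] [cite: Mukai1987ModuliBundlesK3, Cor. 2.6, p. 353] -/
theorem thm_0_1_eq_mukai_sq_add_two (c₁sq r s e χE : K) (hs : s = χE - e * r) :
    c₁sq - 2 * r * χE + r ^ 2 * (2 * e) + 2 = (c₁sq - r * s - s * r) + 2 := by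
  rw [hs]; ring

end RiemannRoch

section Serre

/-- **PROPOSITION 2.4** from PROP. 2.2 and PROP. 2.3: with `h⁰ = dim Hom(E, F)`, `h¹ = dim Ext¹(E, F)`,
`h² = dim Ext²(E, F) = dim Hom(F, E)` (Serre duality, `ω_S` trivial) and `χ(E, F) = h⁰ − h¹ + h² = −(v(E).v(F))`:
`(v(E).v(F)) = dim Ext¹(E, F) − dim Hom(E, F) − dim Hom(F, E)`. [cite: Mukai1987ModuliBundlesK3, Prop. 2.4, p. 352] -/
theorem prop_2_4 (h0 h1 h2 homFE vv : ℤ) (hSerre : h2 = homFE) (hRR : h0 - h1 + h2 = -vv) :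
    vv = h1 - h0 - homFE := by
  linear_combination hRR - hSerre

/-- **COROLLARY 2.5** (`E = F`): `dim Ext¹(E, E) = (v(E)²) + 2 dim End(E)`; in particular `dim Ext¹(E, E) − (v²)` is even.
[cite: Mukai1987ModuliBundlesK3, Cor. 2.5, p. 353] -/
theorem cor_2_5 (endE ext1 ext2 vv : ℤ) (hSerre : ext2 = endE) (hRR : endE - ext1 + ext2 = -vv) :
    ext1 = vv + 2 * endE := by
  linear_combination -hRR + hSerre

/-- **COROLLARY 2.5, parity**: «`dim Ext¹(E, E)` is always an even integer» — given that `(v(E)²)` is even (`H̃(S, ℤ)` is an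
even lattice, p. 351 lines 1–2), `dim Ext¹(E, E) = (v²) + 2 dim End(E)` is even.
[cite: Mukai1987ModuliBundlesK3, Cor. 2.5, p. 353] -/
theorem cor_2_5_even (endE ext1 vv : ℤ) (h : ext1 = vv + 2 * endE) (hvv : Even vv) : Even ext1 := by
  rw [h]
  exact hvv.add (even_two_mul endE)

/-- **COROLLARY 2.5, simple case**: `dim End(E) = 1` ⇒ `dim Ext¹(E, E) = (v(E)²) + 2` and hence `(v(E)²) ≧ −2` (print's `≧`).
[cite: Mukai1987ModuliBundlesK3, Cor. 2.5, p. 353] -/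
theorem cor_2_5_simple (ext1 : ℕ) (endE vv : ℤ) (hsimple : endE = 1) (h : (ext1 : ℤ) = vv + 2 * endE) :
    (ext1 : ℤ) = vv + 2 ∧ -2 ≤ vv := by
  subst hsimple
  constructor
  · linarith
  · have : (0 : ℤ) ≤ ext1 := Int.natCast_nonneg ext1
    linarith

/-- **PROPOSITION 3.2** (K3, `E` simple): with `dim Ext¹(E, E) = (v²) + 2` and `(v²)` even, «rigid» (`Ext¹(E, E) = 0`)
⟺ `(v²) = −2` ⟺ `(v²) < 0`. [cite: Mukai1987ModuliBundlesK3, Prop. 3.2, p. 366] -/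
theorem prop_3_2 (ext1 : ℕ) (vv : ℤ) (h : (ext1 : ℤ) = vv + 2) (hvv : Even vv) :
    (ext1 = 0 ↔ vv = -2) ∧ (vv = -2 ↔ vv < 0) := by
  have h0 : (0 : ℤ) ≤ ext1 := Int.natCast_nonneg ext1
  refine ⟨⟨fun hz => by subst hz; rw [Nat.cast_zero] at h; linarith, fun hm => by exact_mod_cast (show (ext1 : ℤ) = 0 by linarith)⟩,
    ⟨fun hm => by linarith, fun hneg => ?_⟩⟩
  -- `(v²)` even and `−2 ≤ (v²) < 0` forces `(v²) = −2`
  obtain ⟨t, ht⟩ := hvv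
  omega

end Serre

end Mukai1987Numerics

end Literature.AlgebraicGeometry.ModuliOfSheaves
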